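import Literature.Combinatorics.SimpleGraph.HarmonicMorphismsComposition
import HarnessLib

/-!
# Involutions of a graph, the quotient graph `G/ι`, mixing involutions, and non-degenerate
# harmonic morphisms of degree two (Baker–Norine 2009, §5.2: quotients and Lemma 45)

Source (held, read at the page; statements VERBATIM). M. Baker, S. Norine, *Harmonic morphisms
and hyperelliptic graphs*, Int. Math. Res. Not. IMRN 2009, no. 15, 2914–2955 [BakerNorine2009]
(held text `paper:arxiv-0707.1309`, chunks p0016–p0017). §5.2: «Let `H` be a finite group acting
on a graph `G` […]. For `x, y ∈ V(G) ∪ E(G)`, let `x ∼_H y` if there exists an element `h ∈ H`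
such that `h · x = y`. […] The vertices of `G/H` are the equivalence classes of `V(G)` with respect
to `∼_H`. The edges of `G/H` correspond to those equivalence classes of `E(G)` with respect to
`∼_H` which consist of edges whose ends are inequivalent. […] The quotient morphism
`π_H : G → G/H` maps every vertex of `G` to its equivalence class […]. If `H = ⟨φ⟩` is a cyclic
subgroup of `Aut(G)`, we will often write `G/φ` instead of `G/H` and `φ^∼` instead of `π_φ`.»
«An automorphism `ι` of a graph `G` is called an involution if `ι ∘ ι` is the identity
automorphism. We say that an involution `ι` is mixing if for every edge `e = xy ∈ E(G)` such that
`ι(e) = e` we have `ι(x) = y`. Equivalently, `ι` is mixing if and only if it does not fix any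
directed edge of `G`.» **Lemma 45.** «Let `G, G′` be graphs, and let `φ : G → G′` be a
non-degenerate harmonic morphism of degree `2`. Then there is a mixing involution `ι` of `G` for
which `φ = ι^∼`. Conversely, let `|V(G)| > 2` and let `ι : G → G` be a mixing involution. Then
`ι^∼` is a non-degenerate harmonic morphism of degree two.» (proof, first half: «For
`x ∈ V(G)`, if there exists `y ≠ x` such that `φ(y) = φ(x)` then we define `ι(x) = y`. Otherwise,
we define `ι(x) = x`. […] In the second case, `m_φ(x) = 2` and therefore by non-degeneracy of `φ`
we have `x = ι(x)`»; second half: «`|{d ∈ E(G) | x ∈ d, ι^∼(d) = e′}| = 1` if `x ≠ ι(x)` and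
`… = 2` otherwise. It follows that `m_{ι^∼}(x)` is well defined and positive, and that
`Σ_{ι^∼(y) = z} m_{ι^∼}(y) = 2` for every `z ∈ V(G′)`».)

## What is formalised — SIMPLE graphs (the setting of `HarmonicMorphisms`)

For a simple graph an automorphism is a vertex map; an involution `ι` fixes the edge `xy` iff
`{ι(x), ι(y)} = {x, y}`, so «mixing» reads: no edge has both ends fixed (`IsMixing`). The quotient
`G/ι` of the source is a multigraph: between the orbits of `x` and `y` it has one edge per
`ι`-orbit of edges of `G` joining them, i.e. two edges exactly when `x ∼ y`, `x ∼ ι(y)`,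
`ι(x) ≠ x`, `ι(y) ≠ y`. We formalise the underlying simple graph (`imageGraph π G` for any orbit
map `π`, `quotientGraph G ι` on the orbit type) together with the condition `HasSimpleEdgeOrbits`
(«no two edge orbits join the same pair of vertex orbits») under which the multigraph `G/ι` IS
this simple graph; «`G/ι` is a tree» (Theorem 51) is then `IsTree ∧ HasSimpleEdgeOrbits`.
-- TODO(general form): multigraph quotients (edge classes as edges).
* §1 `IsInvolutiveAut G ι` (involutive, adjacency-preserving; `toIso : G ≃g G`), `IsMixing`,
  `HasSimpleEdgeOrbits`;
* §2 orbit maps `IsOrbitMap ι π` (surjective, fibres `{x, ι x}`), the image graph, its adjacency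
  from a vertex (`imageGraph_adj_apply`), connectivity;
* §3 **Lemma 45, second half** (simple form): for a mixing involution with simple edge orbits the
  orbit map is a harmonic morphism `G → G/ι` with `m(x) = 2` at fixed points and `1` elsewhere,
  non-degenerate and of degree `2` as soon as `|V(G)| > 2` (`IsOrbitMap.isHarmonicMorphism`,
  `horizMult_eq`, `harmonicDegree_eq_two`);
* §4 **Lemma 45, first half**: a non-degenerate harmonic morphism of degree `2` is the orbit map
  of a mixing involution with simple edge orbits, `ι(x) = x ↔ m_φ(x) = 2`, and `G′ = G/ι`
  (`IsHarmonicMorphism.exists_involution_of_degree_two`, `imageGraph_eq`);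
* §5 the canonical quotient: `orbitRel`, `quotientGraph`, `isOrbitMap_quotientMk`. (The tree's
  `Literature.Probability.RandomPlanarGeometry.SAW.quotientGraph G 𝒜` is the analogous simple
  quotient by a SUBGROUP `𝒜 ≤ Aut(G)` (Grimmett–Li); B–N's `G/ι` for one involution given as a
  vertex map is typed here on the orbit relation of `ι`, keeping this file free of that module's
  probability imports; for `𝒜 = ⟨ι⟩` both have the classes `{x, ι x}` and the same adjacency.
  Instances on `Quotient (orbitRel ι)` are not declared (no instances in Literature files): the
  statements of §3 are generic in the orbit map and take them as binders; proofs supply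
  `Fintype.ofFinite` / `Classical.decEq`.)

Definitions with bodies and theorems; no `sorry`; no named facts; no instances.
-/

open Finset SimpleGraph Matrix

namespace Literature.Combinatorics.SimpleGraph.BakerNorine

variable {V W : Type*} [Fintype V] [DecidableEq V] (G : SimpleGraph V) [DecidableRel G.Adj]

/-! ### §1 Involutions, mixing, simple edge orbits -/

/-- An **involution** of the simple graph `G`: an adjacency-preserving vertex map with
`ι ∘ ι = id` («An automorphism `ι` of a graph `G` is called an involution if `ι ∘ ι` is the
identity automorphism»). [cite: BakerNorine2009, §5.2] -/
structure IsInvolutiveAut (ι : V → V) : Prop where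
  /-- `ι ∘ ι = id` -/
  involutive : Function.Involutive ι
  /-- `ι` is a graph homomorphism (hence an automorphism) -/
  map_adj : ∀ ⦃x y : V⦄, G.Adj x y → G.Adj (ι x) (ι y)

/-- A **mixing** involution: «for every edge `e = xy ∈ E(G)` such that `ι(e) = e` we have
`ι(x) = y`» — for a simple graph: no edge has both ends fixed. [cite: BakerNorine2009, §5.2] -/
def IsMixing (ι : V → V) : Prop := ∀ ⦃x y : V⦄, G.Adj x y → ι x = x → ι y ≠ y

/-- **Simple edge orbits**: no two `ι`-orbits of edges join the same pair of vertex orbits, i.e.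
the multigraph `G/ι` of the source has no multiple edges (the orbits `{xy, ι(x)ι(y)}` and
`{xι(y), ι(x)y}` coincide or one is absent). [cite: BakerNorine2009, §5.2 (construction of `G/H`:
«The edges of `G/H` correspond to those equivalence classes of `E(G)` … whose ends are
inequivalent»)] -/
def HasSimpleEdgeOrbits (ι : V → V) : Prop :=
  ∀ ⦃x y : V⦄, G.Adj x y → G.Adj x (ι y) → ι x = x ∨ ι y = y

variable {G}

omit [Fintype V] [DecidableEq V] [DecidableRel G.Adj] in
/-- An involution preserves and reflects adjacency. [cite: BakerNorine2009, §5.2] -/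
theorem IsInvolutiveAut.adj_iff {ι : V → V} (h : IsInvolutiveAut G ι) {x y : V} :
    G.Adj (ι x) (ι y) ↔ G.Adj x y :=
  ⟨fun hxy => by simpa [h.involutive x, h.involutive y] using h.map_adj hxy, fun hxy => h.map_adj hxy⟩

/-- The involution as a graph automorphism `G ≃g G`. [cite: BakerNorine2009, §5.2] -/
def IsInvolutiveAut.toIso {ι : V → V} (h : IsInvolutiveAut G ι) : G ≃g G :=
  { h.involutive.toPerm ι with map_rel_iff' := h.adj_iff }

omit [Fintype V] [DecidableEq V] [DecidableRel G.Adj] in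
/-- `toIso` is `ι`. [cite: BakerNorine2009, §5.2] -/
theorem IsInvolutiveAut.coe_toIso {ι : V → V} (h : IsInvolutiveAut G ι) : ⇑h.toIso = ι := rfl

omit [Fintype V] [DecidableEq V] [DecidableRel G.Adj] in
/-- `ι(ι(x)) = x`. [cite: BakerNorine2009, §5.2] -/
theorem IsInvolutiveAut.apply_apply {ι : V → V} (h : IsInvolutiveAut G ι) (x : V) : ι (ι x) = x :=
  h.involutive x

omit [Fintype V] [DecidableEq V] [DecidableRel G.Adj] in
/-- `ι(ι x) = ι x ↔ ι x = x`. [cite: BakerNorine2009, §5.2] -/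
theorem IsInvolutiveAut.apply_eq_self_iff {ι : V → V} (h : IsInvolutiveAut G ι) (x : V) :
    ι (ι x) = ι x ↔ ι x = x := by
  rw [h.involutive x]
  exact ⟨fun h => h.symm, fun h => h.symm⟩

/-! ### §2 Orbit maps and the image graph -/

/-- An **orbit map** of `ι`: a surjection `π : V(G) → W` whose fibres are the orbits `{x, ι(x)}`
(«maps every vertex of `G` to its equivalence class»). [cite: BakerNorine2009, §5.2] -/
structure IsOrbitMap (ι : V → V) (π : V → W) : Prop where
  /-- every class is hit -/
  surjective : Function.Surjective π
  /-- the fibres are the orbits -/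
  apply_eq_iff : ∀ x y : V, π x = π y ↔ y = x ∨ y = ι x

/-- The **image graph** of `G` under a vertex map `π`: distinct `a, b` are adjacent iff some edge
`xy` of `G` has `π(x) = a`, `π(y) = b` (for an orbit map: the simple graph underlying `G/ι`).
[cite: BakerNorine2009, §5.2] -/
abbrev imageGraph (π : V → W) (G : SimpleGraph V) : SimpleGraph W :=
  SimpleGraph.fromRel fun a b => ∃ x y, π x = a ∧ π y = b ∧ G.Adj x y

omit [Fintype V] [DecidableEq V] [DecidableRel G.Adj] in
/-- Adjacency in the image graph. [cite: BakerNorine2009, §5.2] -/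
theorem imageGraph_adj {π : V → W} {a b : W} :
    (imageGraph π G).Adj a b ↔ a ≠ b ∧ ∃ x y, π x = a ∧ π y = b ∧ G.Adj x y := by
  rw [SimpleGraph.fromRel_adj]
  refine and_congr_right fun _ => ⟨fun h => h.elim id ?_, Or.inl⟩
  rintro ⟨x, y, hx, hy, hxy⟩
  exact ⟨y, x, hy, hx, hxy.symm⟩

omit [Fintype V] [DecidableEq V] [DecidableRel G.Adj] in
/-- An edge of `G` maps to an edge or to a vertex of the image graph.
[cite: BakerNorine2009, §5.2 («`π_H` is a surjective morphism of graphs»)] -/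
theorem imageGraph_adj_or_eq (π : V → W) {x y : V} (h : G.Adj x y) :
    (imageGraph π G).Adj (π x) (π y) ∨ π x = π y := by
  by_cases heq : π x = π y
  · exact Or.inr heq
  · exact Or.inl (imageGraph_adj.2 ⟨heq, x, y, rfl, rfl, h⟩)

omit [Fintype V] [DecidableEq V] [DecidableRel G.Adj] in
/-- The image of a connected graph under a surjective map is connected.
[cite: BakerNorine2009, §5.2 («`G/H` is a graph in our sense of the word (i.e., a connected
multigraph …)»)] -/
theorem imageGraph_connected {π : V → W} (hπ : Function.Surjective π) (hG : G.Connected) :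
    (imageGraph π G).Connected := by
  haveI : Nonempty W := Nonempty.map π hG.nonempty
  refine Connected.mk fun a b => ?_
  obtain ⟨x, rfl⟩ := hπ a
  obtain ⟨y, rfl⟩ := hπ b
  obtain ⟨p⟩ := hG.preconnected x y
  induction p with
  | nil => rfl
  | cons hadj _ ih =>
    refine Reachable.trans ?_ ih
    rcases imageGraph_adj_or_eq π hadj with h | h
    · exact h.reachable
    · rw [h]

section OrbitMap

variable {ι : V → V} {π : V → W} (hπ : IsOrbitMap ι π)
include hπ

omit [Fintype V] [DecidableEq V] [DecidableRel G.Adj] in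
/-- `π(ι(x)) = π(x)`. [cite: BakerNorine2009, §5.2 («`π_H(h · x) = π_H(x)`»)] -/
theorem IsOrbitMap.apply_ι (x : V) : π (ι x) = π x :=
  ((hπ.apply_eq_iff x (ι x)).2 (Or.inr rfl)).symm

omit [Fintype V] [DecidableEq V] [DecidableRel G.Adj] in
/-- Adjacency of the image graph read from a vertex `x`: `π(x) ∼ b` iff `b ≠ π(x)` and `x` has a
neighbour over `b`. [cite: BakerNorine2009, §5.2 (Lemma 45, proof: «there exists an edge `e = xx′`
in `G` such that `ι^∼(e) = e′`»)] -/
theorem IsOrbitMap.imageGraph_adj_apply (hι : IsInvolutiveAut G ι) {x : V} {b : W} :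
    (imageGraph π G).Adj (π x) b ↔ π x ≠ b ∧ ∃ y, π y = b ∧ G.Adj x y := by
  rw [imageGraph_adj]
  refine and_congr_right fun _ => ⟨?_, ?_⟩
  · rintro ⟨x', y, hx', hy, h⟩
    rcases (hπ.apply_eq_iff x x').1 hx'.symm with rfl | rfl
    · exact ⟨y, hy, h⟩
    · refine ⟨ι y, by rw [hπ.apply_ι, hy], ?_⟩
      have := hι.map_adj h
      rwa [hι.involutive x] at this
  · rintro ⟨y, hy, h⟩
    exact ⟨x, y, rfl, hy, h⟩

omit [DecidableRel G.Adj] in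
/-- With at least three vertices the quotient has at least two (orbits have at most two
elements). [cite: BakerNorine2009, Lemma 45 (proof: «`|V(G′)| ≥ |V(G)|/2 > 1`»)] -/
theorem IsOrbitMap.nontrivial (hV : 2 < Fintype.card V) : Nontrivial W := by
  classical
  by_contra hW
  rw [not_nontrivial_iff_subsingleton] at hW
  obtain ⟨x⟩ : Nonempty V := Fintype.card_pos_iff.1 (by omega)
  have hsub : (univ : Finset V) ⊆ {x, ι x} := fun y _ => by
    rcases (hπ.apply_eq_iff x y).1 (Subsingleton.elim _ _) with rfl | rfl <;> simp
  have := (Finset.card_le_card hsub).trans (Finset.card_le_two)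
  rw [Finset.card_univ] at this
  omega

/-! ### §3 Lemma 45, second half: the orbit map of a mixing involution is harmonic of degree 2 -/

/-- The count of Lemma 45: over a neighbour `b` of `π(x)`, the vertex `x` has `2` neighbours if
`ι(x) = x` and `1` otherwise («`|{d ∈ E(G) | x ∈ d, ι^∼(d) = e′}| = 1` if `x ≠ ι(x)` and `2`
otherwise»; simple edge orbits needed in the simple-graph form).
[cite: BakerNorine2009, Lemma 45 (proof of the converse)] -/
theorem IsOrbitMap.card_filter_eq [DecidableEq W] (hι : IsInvolutiveAut G ι) (hm : IsMixing G ι)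
    (hs : HasSimpleEdgeOrbits G ι) {x : V} {b : W} (hb : (imageGraph π G).Adj (π x) b) :
    #{u ∈ G.neighborFinset x | π u = b} = if ι x = x then 2 else 1 := by
  obtain ⟨hne, y, rfl, hxy⟩ := (hπ.imageGraph_adj_apply hι).1 hb
  have hsub : ({u ∈ G.neighborFinset x | π u = π y} : Finset V) ⊆ {y, ι y} := fun u hu => by
    rw [mem_filter] at hu
    rcases (hπ.apply_eq_iff y u).1 hu.2.symm with rfl | rfl <;> simp
  have hy : y ∈ ({u ∈ G.neighborFinset x | π u = π y} : Finset V) :=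
    mem_filter.2 ⟨(mem_neighborFinset _ _ _).2 hxy, rfl⟩
  split_ifs with hx
  · -- `x` fixed: `x ∼ ι y` too, and `ι y ≠ y` by mixing
    have hxy' : G.Adj x (ι y) := by simpa [hx] using hι.map_adj hxy
    have hyy : ι y ≠ y := hm hxy hx
    have heq : ({u ∈ G.neighborFinset x | π u = π y} : Finset V) = {y, ι y} := by
      refine Finset.Subset.antisymm hsub ?_
      intro u hu
      simp only [mem_insert, mem_singleton] at hu
      rcases hu with rfl | rfl
      · exact hy
      · exact mem_filter.2 ⟨(mem_neighborFinset _ _ _).2 hxy', hπ.apply_ι _⟩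
    rw [heq, Finset.card_pair hyy.symm]
  · -- `x` not fixed: `ι y` is not a second neighbour over `π y` (simple edge orbits)
    rw [Finset.card_eq_one]
    refine ⟨y, Finset.Subset.antisymm (fun u hu => ?_) (Finset.singleton_subset_iff.2 hy)⟩
    have hu' := hsub hu
    rw [mem_filter, mem_neighborFinset] at hu
    simp only [mem_insert, mem_singleton] at hu' ⊢
    rcases hu' with rfl | rfl
    · rfl
    · rcases hs hxy hu.1 with h | h
      · exact absurd h hx
      · exact h

/-- **Lemma 45 (converse), harmonicity**: the orbit map of a mixing involution with simple edge
orbits is a harmonic morphism `G → G/ι`. [cite: BakerNorine2009, Lemma 45] -/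
theorem IsOrbitMap.isHarmonicMorphism [DecidableEq W] (hι : IsInvolutiveAut G ι) (hm : IsMixing G ι)
    (hs : HasSimpleEdgeOrbits G ι) : IsHarmonicMorphism G (imageGraph π G) π where
  adj_or_eq := fun _ _ h => imageGraph_adj_or_eq π h
  conformal := fun x b₁ b₂ h₁ h₂ => by
    rw [hπ.card_filter_eq hι hm hs h₁, hπ.card_filter_eq hι hm hs h₂]

/-- **Lemma 45 (converse), multiplicities**: `m(x) = 2` if `ι(x) = x` and `1` otherwise, at any
`x` whose class has a neighbour. [cite: BakerNorine2009, Lemma 45 (proof)] -/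
theorem IsOrbitMap.horizMult_eq [Fintype W] [DecidableEq W] [DecidableRel (imageGraph π G).Adj]
    (hι : IsInvolutiveAut G ι) (hm : IsMixing G ι) (hs : HasSimpleEdgeOrbits G ι) {x : V}
    (hx : ∃ b, (imageGraph π G).Adj (π x) b) :
    horizMult G (imageGraph π G) π x = if ι x = x then 2 else 1 := by
  obtain ⟨b, hb⟩ := hx
  rw [(hπ.isHarmonicMorphism hι hm hs).horizMult_eq hb, hπ.card_filter_eq hι hm hs hb]

omit [DecidableRel G.Adj] in
/-- For `|V(G)| > 2` and `G` connected every class has a neighbour in `G/ι`.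
[cite: BakerNorine2009, Lemma 45 (proof: «Note that `|V(G′)| ≥ |V(G)|/2 > 1`»)] -/
theorem IsOrbitMap.exists_adj (hG : G.Connected) (hV : 2 < Fintype.card V) (x : V) :
    ∃ b, (imageGraph π G).Adj (π x) b := by
  haveI := hπ.nontrivial hV
  exact (imageGraph_connected hπ.surjective hG).preconnected.exists_adj_of_nontrivial (π x)

/-- **Lemma 45 (converse), non-degeneracy**: `m(x) ≥ 1` everywhere (`|V(G)| > 2`, `G` connected).
[cite: BakerNorine2009, Lemma 45] -/
theorem IsOrbitMap.one_le_horizMult [Fintype W] [DecidableEq W] [DecidableRel (imageGraph π G).Adj]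
    (hι : IsInvolutiveAut G ι) (hm : IsMixing G ι) (hs : HasSimpleEdgeOrbits G ι) (hG : G.Connected)
    (hV : 2 < Fintype.card V) (x : V) : 1 ≤ horizMult G (imageGraph π G) π x := by
  rw [hπ.horizMult_eq hι hm hs (hπ.exists_adj hG hV x)]
  split_ifs <;> omega

/-- **Lemma 45 (converse), degree**: «`Σ_{ι^∼(y) = z} m_{ι^∼}(y) = 2` for every `z`» (`|V(G)| > 2`,
`G` connected). [cite: BakerNorine2009, Lemma 45] -/
theorem IsOrbitMap.harmonicDegree_eq_two [Fintype W] [DecidableEq W]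
    [DecidableRel (imageGraph π G).Adj] (hι : IsInvolutiveAut G ι) (hm : IsMixing G ι)
    (hs : HasSimpleEdgeOrbits G ι) (hG : G.Connected) (hV : 2 < Fintype.card V) (b : W) :
    harmonicDegree G (imageGraph π G) π b = 2 := by
  obtain ⟨y, rfl⟩ := hπ.surjective b
  rw [harmonicDegree_apply]
  have hfib : univ.filter (fun x => π x = π y) = ({y, ι y} : Finset V) := by
    ext x
    simp only [mem_filter, mem_univ, true_and, mem_insert, mem_singleton]
    rw [eq_comm, hπ.apply_eq_iff y x]
  rw [hfib]
  by_cases hy : ι y = y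
  · rw [hy, Finset.insert_eq_of_mem (Finset.mem_singleton_self y), Finset.sum_singleton, hπ.horizMult_eq hι hm hs (hπ.exists_adj hG hV y),
      if_pos hy]
  · rw [Finset.sum_pair (Ne.symm hy), hπ.horizMult_eq hι hm hs (hπ.exists_adj hG hV y), if_neg hy,
      hπ.horizMult_eq hι hm hs (hπ.exists_adj hG hV (ι y)), if_neg (by rw [hι.involutive y]; exact Ne.symm hy)]

omit [DecidableEq V] in
/-- The vertical multiplicity of the orbit map: `v(x) = 1` if `x ∼ ι(x)`, else `0`.
[cite: BakerNorine2009, §2.1 (eq. (2.1)) with §5.2] -/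
theorem IsOrbitMap.vertMult_eq [DecidableEq W] (x : V) :
    vertMult G π x = if G.Adj x (ι x) then 1 else 0 := by
  rw [vertMult_apply]
  have hsub : ({u ∈ G.neighborFinset x | π u = π x} : Finset V) =
      if G.Adj x (ι x) then {ι x} else ∅ := by
    ext u
    simp only [mem_filter, mem_neighborFinset]
    rw [eq_comm, hπ.apply_eq_iff x u]
    split_ifs with h
    · simp only [mem_singleton]
      constructor
      · rintro ⟨hu, rfl | rfl⟩
        · exact absurd hu G.irrefl
        · rfl
      · rintro rfl
        exact ⟨h, Or.inr rfl⟩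
    · simp only [Finset.notMem_empty, iff_false, not_and]
      rintro hu (rfl | rfl)
      · exact absurd hu G.irrefl
      · exact h hu
  rw [hsub]
  split_ifs <;> simp

/-- The pull-back of a vertex of `G/ι` along the orbit map is the orbit: `π^*((π x)) =
(x) + (ι(x))` (`= 2(x)` at a fixed point; `|V(G)| > 2`, `G` connected).
[cite: BakerNorine2009, Theorem 51 (proof: «`φ^*((x)) = (x) + (ι(x))`»)] -/
theorem IsOrbitMap.divPullback_single [Fintype W] [DecidableEq W]
    [DecidableRel (imageGraph π G).Adj] (hι : IsInvolutiveAut G ι) (hm : IsMixing G ι)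
    (hs : HasSimpleEdgeOrbits G ι) (hG : G.Connected) (hV : 2 < Fintype.card V) (x : V) :
    divPullback G (imageGraph π G) π (Pi.single (π x) 1) = Pi.single x 1 + Pi.single (ι x) 1 := by
  funext z
  rw [divPullback_apply, hπ.horizMult_eq hι hm hs (hπ.exists_adj hG hV z), Pi.add_apply]
  by_cases hz : π z = π x
  · rw [hz, Pi.single_eq_same, mul_one]
    rcases (hπ.apply_eq_iff x z).1 hz.symm with rfl | rfl
    · by_cases h : ι z = z
      · rw [if_pos h, h, Pi.single_eq_same]; rfl
      · rw [if_neg h, Pi.single_eq_same, Pi.single_eq_of_ne (Ne.symm h)]; rfl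
    · rw [hι.involutive x]
      by_cases h : x = ι x
      · rw [← h, if_pos rfl, Pi.single_eq_same]; rfl
      · rw [if_neg h, Pi.single_eq_of_ne (Ne.symm h), Pi.single_eq_same]; rfl
  · rw [Pi.single_eq_of_ne hz, mul_zero]
    have h1 : z ≠ x := fun h => hz (by rw [h])
    have h2 : z ≠ ι x := fun h => hz (by rw [h, hπ.apply_ι])
    rw [Pi.single_eq_of_ne h1, Pi.single_eq_of_ne h2, add_zero]

end OrbitMap

/-! ### §4 Lemma 45, first half: a non-degenerate degree-two harmonic morphism is an orbit map -/

section DegreeTwo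

variable {V' : Type*} [Fintype V'] [DecidableEq V'] {G' : SimpleGraph V'} [DecidableRel G'.Adj]
variable {φ : V → V'} (hφ : IsHarmonicMorphism G G' φ) (hnd : ∀ x, 1 ≤ horizMult G G' φ x)
  (hdeg : ∀ y, harmonicDegree G G' φ y = 2)
include hφ hnd hdeg

omit hφ in
/-- A fibre of a non-degenerate degree-`2` morphism has at most two points: three distinct points
would contribute `m ≥ 3`. [cite: BakerNorine2009, Lemma 45 (proof)] -/
theorem eq_or_eq_of_degree_two {x y z : V} (hxy : φ y = φ x) (hxz : φ z = φ x)
    (hne : y ≠ x) : z = x ∨ z = y := by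
  by_contra h
  push Not at h
  have h2 := hdeg (φ x)
  rw [harmonicDegree_apply] at h2
  have hsub : ({x, y, z} : Finset V) ⊆ univ.filter (fun u => φ u = φ x) := by
    intro u hu
    simp only [mem_insert, mem_singleton] at hu
    rcases hu with rfl | rfl | rfl <;> simp [hxy, hxz]
  have hcard : #({x, y, z} : Finset V) = 3 := by
    rw [Finset.card_insert_of_notMem (by simp [hne.symm, h.1.symm]), Finset.card_pair h.2.symm]
  have := Finset.sum_le_sum_of_subset_of_nonneg hsub (fun u _ _ => Nat.zero_le (horizMult G G' φ u))
  have h3 : 3 ≤ ∑ u ∈ ({x, y, z} : Finset V), horizMult G G' φ u :=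
    hcard ▸ (Finset.card_eq_sum_ones _).symm ▸ Finset.sum_le_sum fun u _ => hnd u
  omega

omit hφ in
/-- `m_φ(x) = 2` iff `x` is alone in its fibre. [cite: BakerNorine2009, Lemma 45 (proof: «In the
second case, `m_φ(x) = 2` and therefore […] `x = ι(x)`»)] -/
theorem horizMult_eq_two_iff (x : V) :
    horizMult G G' φ x = 2 ↔ ∀ y, φ y = φ x → y = x := by
  have h2 := hdeg (φ x)
  rw [harmonicDegree_apply] at h2
  have hx : x ∈ univ.filter (fun u => φ u = φ x) := mem_filter.2 ⟨mem_univ _, rfl⟩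
  constructor
  · intro hm y hy
    by_contra hne
    have hy' : y ∈ univ.filter (fun u => φ u = φ x) := mem_filter.2 ⟨mem_univ _, hy⟩
    have hsub : ({x, y} : Finset V) ⊆ univ.filter (fun u => φ u = φ x) := by
      intro u hu
      simp only [mem_insert, mem_singleton] at hu
      rcases hu with rfl | rfl
      · exact hx
      · exact hy'
    have := Finset.sum_le_sum_of_subset_of_nonneg hsub
      (fun u _ _ => Nat.zero_le (horizMult G G' φ u))
    rw [Finset.sum_pair (Ne.symm hne), hm] at this
    have := hnd y
    omega
  · intro h
    have hset : univ.filter (fun u => φ u = φ x) = {x} := by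
      ext u
      simp only [mem_filter, mem_univ, true_and, mem_singleton]
      exact ⟨h u, fun hu => by rw [hu]⟩
    rw [hset, Finset.sum_singleton] at h2
    exact h2

/-- **Lemma 45, first half**: a non-degenerate harmonic morphism of degree `2` (onto a connected
`G′`) is the orbit map of a mixing involution of `G` with simple edge orbits, whose fixed points
are the vertices with `m_φ = 2` («if there exists `y ≠ x` such that `φ(y) = φ(x)` then we define
`ι(x) = y`. Otherwise, we define `ι(x) = x`»). [cite: BakerNorine2009, Lemma 45] -/
theorem IsHarmonicMorphism.exists_involution_of_degree_two :
    ∃ ι : V → V, IsInvolutiveAut G ι ∧ IsMixing G ι ∧ HasSimpleEdgeOrbits G ι ∧ IsOrbitMap ι φ ∧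
      ∀ x, ι x = x ↔ horizMult G G' φ x = 2 := by
  classical
  -- the printed definition of `ι`
  let ι : V → V := fun x => if h : ∃ y, y ≠ x ∧ φ y = φ x then h.choose else x
  have hιspec : ∀ x, (∃ y, y ≠ x ∧ φ y = φ x) → ι x ≠ x ∧ φ (ι x) = φ x := fun x h => by
    simp only [ι, dif_pos h]
    exact h.choose_spec
  have hιfix : ∀ x, (¬ ∃ y, y ≠ x ∧ φ y = φ x) → ι x = x := fun x h => by
    simp only [ι, dif_neg h]
  have hφι : ∀ x, φ (ι x) = φ x := fun x => by
    by_cases h : ∃ y, y ≠ x ∧ φ y = φ x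
    · exact (hιspec x h).2
    · rw [hιfix x h]
  -- fibres are `{x, ι x}`
  have hfib : ∀ x y, φ x = φ y ↔ y = x ∨ y = ι x := by
    intro x y
    constructor
    · intro hxy
      by_cases hyx : y = x
      · exact Or.inl hyx
      · have hex : ∃ y, y ≠ x ∧ φ y = φ x := ⟨y, hyx, hxy.symm⟩
        obtain ⟨hne, hφ'⟩ := hιspec x hex
        rcases eq_or_eq_of_degree_two hnd hdeg hφ' hxy.symm hne with h | h
        · exact absurd h hyx
        · exact Or.inr h
    · rintro (rfl | rfl)
      · rfl
      · exact (hφι x).symm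
  have hinv : Function.Involutive ι := fun x => by
    by_cases h : ∃ y, y ≠ x ∧ φ y = φ x
    · obtain ⟨hne, hφ'⟩ := hιspec x h
      have hex : ∃ y, y ≠ ι x ∧ φ y = φ (ι x) := ⟨x, hne.symm, hφ'.symm⟩
      obtain ⟨hne', hφ''⟩ := hιspec (ι x) hex
      rcases (hfib x (ι (ι x))).1 (by rw [hφ'', hφ']) with h1 | h1
      · exact h1
      · exact absurd h1 hne'
    · rw [hιfix x h, hιfix x h]
  have hfix : ∀ x, ι x = x ↔ horizMult G G' φ x = 2 := fun x => by
    rw [horizMult_eq_two_iff hnd hdeg]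
    constructor
    · intro hx y hy
      rcases (hfib x y).1 hy.symm with h | h
      · exact h
      · rw [h, hx]
    · intro h
      by_contra hne
      exact hne (h (ι x) (hφι x))
  -- `m = 1` off the fixed points
  have hone : ∀ x, ι x ≠ x → horizMult G G' φ x = 1 := fun x hx => by
    have h2 := hdeg (φ x)
    rw [harmonicDegree_apply] at h2
    have hset : univ.filter (fun u => φ u = φ x) = {x, ι x} := by
      ext u
      simp only [mem_filter, mem_univ, true_and, mem_insert, mem_singleton]
      rw [eq_comm, hfib x u]
    rw [hset, Finset.sum_pair (Ne.symm hx)] at h2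
    have := hnd x; have := hnd (ι x)
    omega
  refine ⟨ι, ⟨hinv, ?_⟩, ?_, ?_, ⟨fun y => ?_, hfib⟩, hfix⟩
  · -- `ι` preserves adjacency
    intro x u hxu
    rcases hφ.adj_or_eq hxu with hh | hv
    · -- horizontal edge
      by_cases hx : ι x = x
      · -- `m(x) = 2`: both points of the fibre `{u, ι u}` are neighbours of `x`
        have hm : horizMult G G' φ x = 2 := (hfix x).1 hx
        rw [hφ.horizMult_eq hh] at hm
        obtain ⟨a, b, hab, hset⟩ := Finset.card_eq_two.1 hm
        have hu' : ι u ≠ u := by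
          intro hfu
          have : ({w ∈ G.neighborFinset x | φ w = φ u} : Finset V) ⊆ {u} := fun w hw => by
            rw [mem_filter] at hw
            rcases (hfib u w).1 hw.2.symm with h | h
            · exact mem_singleton.2 h
            · rw [hfu] at h; exact mem_singleton.2 h
          have := Finset.card_le_card this
          rw [hset, Finset.card_pair hab, Finset.card_singleton] at this
          omega
        -- the neighbour of `x` over `φ u` other than `u` is `ι u`
        have hιu : ι u ∈ ({w ∈ G.neighborFinset x | φ w = φ u} : Finset V) := by
          by_contra hnot
          have : ({w ∈ G.neighborFinset x | φ w = φ u} : Finset V) ⊆ {u} := fun w hw => by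
            have hw' := hw
            rw [mem_filter] at hw'
            rcases (hfib u w).1 hw'.2.symm with h | h
            · exact mem_singleton.2 h
            · rw [h] at hw; exact absurd hw hnot
          have := Finset.card_le_card this
          rw [hset, Finset.card_pair hab, Finset.card_singleton] at this
          omega
        rw [mem_filter, mem_neighborFinset] at hιu
        rw [hx]
        exact hιu.1
      · -- `m(ι x) = 1`: the neighbour `w` of `ι x` over `φ u` is `ι u` (or `u = ι u`)
        have hιx : G'.Adj (φ (ι x)) (φ u) := by rw [hφι]; exact hh
        have hm := hone (ι x) (by rw [hinv x]; exact Ne.symm hx)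
        rw [hφ.horizMult_eq hιx] at hm
        obtain ⟨w, hw⟩ := Finset.card_eq_one.1 hm
        have hw' : w ∈ ({w' ∈ G.neighborFinset (ι x) | φ w' = φ u} : Finset V) := by
          rw [hw]; exact mem_singleton_self w
        rw [mem_filter, mem_neighborFinset] at hw'
        rcases (hfib u w).1 hw'.2.symm with rfl | rfl
        · -- `w = u`: then `u` has the two neighbours `x, ι x` over `φ x`, so `m(u) = 2`, `ι u = u`
          have hm2 : horizMult G G' φ w = 2 := by
            have hux : G'.Adj (φ w) (φ x) := hh.symm
            rw [hφ.horizMult_eq hux]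
            have hsub : ({x, ι x} : Finset V) ⊆ {w' ∈ G.neighborFinset w | φ w' = φ x} := by
              intro w' hw''
              simp only [mem_insert, mem_singleton] at hw''
              rcases hw'' with rfl | rfl
              · exact mem_filter.2 ⟨(mem_neighborFinset _ _ _).2 hxu.symm, rfl⟩
              · exact mem_filter.2 ⟨(mem_neighborFinset _ _ _).2 hw'.1.symm, hφι _⟩
            have h1 := Finset.card_le_card hsub
            rw [Finset.card_pair (Ne.symm hx)] at h1
            have h2 : #{w' ∈ G.neighborFinset w | φ w' = φ x} ≤ 2 := by
              rw [← hφ.horizMult_eq hux]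
              have hd := hdeg (φ w)
              rw [harmonicDegree_apply] at hd
              have hle : horizMult G G' φ w ≤
                  ∑ u ∈ univ.filter (fun u => φ u = φ w), horizMult G G' φ u :=
                Finset.single_le_sum (s := univ.filter (fun u => φ u = φ w))
                  (f := fun u => horizMult G G' φ u) (fun u _ => Nat.zero_le _)
                  (mem_filter.2 ⟨mem_univ w, rfl⟩)
              omega
            omega
          rw [(hfix w).2 hm2]
          exact hw'.1
        · exact hw'.1
    · -- vertical edge: `u = ι x`
      rcases (hfib x u).1 hv with rfl | rfl
      · exact absurd hxu G.irrefl
      · rw [hinv x]; exact hxu.symm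
  · -- mixing
    intro x u hxu hx hu
    rcases hφ.adj_or_eq hxu with hh | hv
    · have hm : horizMult G G' φ x = 2 := (hfix x).1 hx
      rw [hφ.horizMult_eq hh] at hm
      have : ({w ∈ G.neighborFinset x | φ w = φ u} : Finset V) ⊆ {u} := fun w hw => by
        rw [mem_filter] at hw
        rcases (hfib u w).1 hw.2.symm with h | h
        · exact mem_singleton.2 h
        · rw [hu] at h; exact mem_singleton.2 h
      have := Finset.card_le_card this
      rw [hm, Finset.card_singleton] at this
      omega
    · rcases (hfib x u).1 hv with rfl | rfl
      · exact absurd hxu G.irrefl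
      · exact (G.ne_of_adj hxu) hx.symm
  · -- simple edge orbits
    intro x y hxy hxy'
    by_contra h
    push Not at h
    have hh : G'.Adj (φ x) (φ y) := by
      rcases hφ.adj_or_eq hxy with hh | hv
      · exact hh
      · exfalso
        rcases (hfib x y).1 hv with rfl | rfl
        · exact absurd hxy G.irrefl
        · rw [hinv x] at hxy'
          exact absurd hxy' G.irrefl
    have hm := hone x h.1
    rw [hφ.horizMult_eq hh] at hm
    have hsub : ({y, ι y} : Finset V) ⊆ {w ∈ G.neighborFinset x | φ w = φ y} := by
      intro w hw
      simp only [mem_insert, mem_singleton] at hw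
      rcases hw with rfl | rfl
      · exact mem_filter.2 ⟨(mem_neighborFinset _ _ _).2 hxy, rfl⟩
      · exact mem_filter.2 ⟨(mem_neighborFinset _ _ _).2 hxy', hφι _⟩
    have := Finset.card_le_card hsub
    rw [Finset.card_pair (Ne.symm h.2), hm] at this
    omega
  · -- surjective
    have h2 := hdeg y
    rw [harmonicDegree_apply] at h2
    by_contra hy
    push Not at hy
    rw [Finset.filter_eq_empty_iff.2 (fun x _ => hy x), Finset.sum_empty] at h2
    exact absurd h2 (by norm_num)

omit [DecidableEq V] in
/-- For a non-degenerate harmonic morphism onto `G′`, `G′` is the image graph: «`φ = ι^∼`», i.e.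
`G′ = G/ι` for the involution of Lemma 45. [cite: BakerNorine2009, Lemma 45] -/
theorem IsHarmonicMorphism.imageGraph_eq : imageGraph φ G = G' := by
  ext a b
  rw [imageGraph_adj]
  constructor
  · rintro ⟨hne, x, y, rfl, rfl, hxy⟩
    rcases hφ.adj_or_eq hxy with h | h
    · exact h
    · exact absurd h hne
  · intro hab
    have hsurj : Function.Surjective φ := fun y => by
      have h2 := hdeg y
      rw [harmonicDegree_apply] at h2
      by_contra hy
      push Not at hy
      rw [Finset.filter_eq_empty_iff.2 (fun x _ => hy x), Finset.sum_empty] at h2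
      exact absurd h2 (by norm_num)
    obtain ⟨x, rfl⟩ := hsurj a
    refine ⟨G'.ne_of_adj hab, x, ?_⟩
    have hm := hnd x
    rw [hφ.horizMult_eq hab, Finset.one_le_card] at hm
    obtain ⟨y, hy⟩ := hm
    rw [mem_filter, mem_neighborFinset] at hy
    exact ⟨y, rfl, hy.2, hy.1⟩

end DegreeTwo

/-! ### §5 The canonical quotient `G/ι` -/

/-- The orbit relation of a map `ι` (an equivalence relation; for an involution its classes are
the orbits `{x, ι x}`). [cite: BakerNorine2009, §5.2 («`x ∼_H y` if there exists `h ∈ H` such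
that `h · x = y`»)] -/
abbrev orbitRel (ι : V → V) : Setoid V where
  r x y := x = y ∨ (y = ι x ∧ x = ι y)
  iseqv :=
    ⟨fun _ => Or.inl rfl,
      fun h => h.elim (fun h => Or.inl h.symm) fun h => Or.inr ⟨h.2, h.1⟩,
      fun h₁ h₂ => h₁.elim (fun h₁ => h₁ ▸ h₂) fun h₁ => h₂.elim (fun h₂ => h₂ ▸ Or.inr h₁)
        fun h₂ => Or.inl (h₁.2.trans h₂.1.symm)⟩

/-- **The quotient graph `G/ι`** (its underlying simple graph) on the orbit type.
[cite: BakerNorine2009, §5.2] -/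
abbrev quotientGraph (G : SimpleGraph V) (ι : V → V) : SimpleGraph (Quotient (orbitRel ι)) :=
  imageGraph (Quotient.mk (orbitRel ι)) G

omit [Fintype V] [DecidableEq V] in
/-- For an involution, `⟦x⟧ = ⟦y⟧ ↔ y ∈ {x, ι x}`. [cite: BakerNorine2009, §5.2] -/
theorem orbitRel_mk_eq_iff {ι : V → V} (hι : Function.Involutive ι) (x y : V) :
    (Quotient.mk (orbitRel ι) x = Quotient.mk (orbitRel ι) y) ↔ y = x ∨ y = ι x := by
  rw [Quotient.eq]
  show (x = y ∨ (y = ι x ∧ x = ι y)) ↔ _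
  constructor
  · rintro (rfl | ⟨h, -⟩)
    · exact Or.inl rfl
    · exact Or.inr h
  · rintro (rfl | rfl)
    · exact Or.inl rfl
    · exact Or.inr ⟨rfl, (hι x).symm⟩

omit [Fintype V] [DecidableEq V] in
/-- The quotient map `x ↦ ⟦x⟧` is an orbit map («The quotient morphism `π_H : G → G/H` maps
every vertex of `G` to its equivalence class»). [cite: BakerNorine2009, §5.2] -/
theorem isOrbitMap_quotientMk {ι : V → V} (hι : Function.Involutive ι) :
    IsOrbitMap ι (Quotient.mk (orbitRel ι)) where
  surjective := Quotient.mk_surjective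
  apply_eq_iff := orbitRel_mk_eq_iff hι

end Literature.Combinatorics.SimpleGraph.BakerNorine
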